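import Literature.AlgebraicGeometry.ModuliOfAbelianVarieties.SiegelCanonicalModel
import Mathlib.LinearAlgebra.Eigenspace.Semisimple
import Mathlib.LinearAlgebra.Eigenspace.Minpoly
import Mathlib.LinearAlgebra.Semisimple
import Mathlib.NumberTheory.NumberField.InfinitePlace.Embeddings
import Mathlib.FieldTheory.PrimitiveElement
import HarnessLib

/-!
# The special point of a CM structure on the Siegel datum is determined by its CM types
# ([Deligne 1971] 4.18; [Milne ISV] Ex. 12.4 (b): `h_Φ` is determined by `Φ`)

Topic `AlgebraicGeometry/ModuliOfAbelianVarieties`; namespace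
`Literature.AlgebraicGeometry.ModuliOfAbelianVarieties.CMStructure`.  THEOREMS ONLY (no definition, no named fact, no
instance, no `sorry`; net Literature debt **0**).  Sequel of ★ (σ4)-D `SiegelCanonicalModel` (`CMStructure`, `IsSpecial`).
Cell hodgecm-mathlib (D-0151), banked GENERIC leaf R60-10 toward fan-B row I-7 (#60) `SiegelS1` (director g6 RULING s86 (2)(b);
census memo `CENSUS-60-SiegelS1.A-p05g7.md` §3 M3 (ii)).

WHAT IS PROVED.  Let `c` be a CM structure of type `δ` ([Deligne1971TravauxShimura] 4.18): an injective `ℚ`-algebra map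
`act : F = ∏ᵢ Kᵢ → End_ℚ(ℚ^{2g})`, `Kᵢ` CM number fields.
* §1 STRUCTURE LEMMA `CMStructure.iSup_eigenline_eq_top` — the common eigenlines of `F` on `ℂ^{2g}`,
  `V_{i,ρ} = {v | act(ιᵢ x)·v = ρ(x)·v for all x ∈ Kᵢ}` (`ιᵢ = Pi.single i`, `ρ : Kᵢ → ℂ`), SPAN `ℂ^{2g}`:
  `⨆_{(i,ρ)} V_{i,ρ} = ⊤`.  Proof: `v = Σᵢ eᵢ v` for the idempotents `eᵢ = act(ιᵢ 1)`; a primitive element `x₀ ≠ 0` of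
  `Kᵢ/ℚ` acts through the separable split polynomial `X · minpoly_ℚ(x₀)`, so `act(ιᵢ x₀)` is semisimple on `ℂ^{2g}`
  (Mathlib `Module.End.isSemisimple_of_squarefree_aeval_eq_zero`) and its eigenspaces span
  (`Module.End.IsSemisimple.iSup_eigenspace_eq_top`); a non-zero eigenvalue is `ρ(x₀)` for a complex embedding `ρ`
  (`NumberField.Embeddings.range_eval_eq_rootSet_minpoly`), and on `eᵢ ℂ^{2g}` the eigenvector condition propagates from
  `x₀` to `ℚ(x₀) = Kᵢ`.  (No use of `[F : ℚ] = 2g`: the lines may have any dimension.)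
* §2 HEAD `CMStructure.IsSpecial.coe_eq_coe` / `IsSpecial.eq` — if `(c, J)` and `(c, J′)` are special pairs with the SAME
  CM types `Φ` (`c.IsSpecial J Φ`, `c.IsSpecial J′ Φ`) then `J = J′`: both are `+i` on `V_{i,ρ}` for `ρ ∈ Φᵢ` and `−i`
  otherwise, and §1.  [Milne2005ShimuraVarieties] Ex. 12.4 (b): «`h_Φ(z)` acts on `V_φ` as multiplication by `φ(z)`» —
  the special point `h_Φ` is a function of `Φ`; so the `∀ J ∀ Φ, IsSpecial J Φ →` of ★ `SiegelRationalModel.IsCanonical`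
  is a quantifier over the CM types alone (strength reading for the cell's row #60).
Nothing printed is asserted.  HC_CM is proved only modulo the 7 printed citations until rung 0 closes.

## References
* [Deligne1971TravauxShimura] P. Deligne, *Travaux de Shimura*, Sém. Bourbaki 389 (1971), 4.18 p. 150.
* [Milne2005ShimuraVarieties] J. S. Milne, *Introduction to Shimura varieties* (2005), Ex. 12.4 (b) p. 112, §14 p. 125.
* [MilneCM2006] J. S. Milne, *Complex Multiplication* (2006), Ch. I §1 (CM algebras, `E ⊗ ℂ ≅ ∏_φ ℂ`).
* [Shimura1998] G. Shimura, *Abelian Varieties with Complex Multiplication and Modular Functions* (1998), §5.1 Lemma 1.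
-/

set_option autoImplicit false

noncomputable section

open Matrix NumberField Polynomial
open scoped IntermediateField

namespace Literature.AlgebraicGeometry.ModuliOfAbelianVarieties

namespace CMStructure

open Literature.AlgebraicGeometry.Motives (CMType)

variable {g : ℕ} {δ : Fin g → ℕ} {ι : Type} [Fintype ι] [DecidableEq ι] {K : ι → Type} [∀ i, Field (K i)]
  [∀ i, NumberField (K i)] [∀ i, IsCMField (K i)] (c : CMStructure g δ ι K)

/-! ### §1. The common eigenlines of `F = ∏ Kᵢ` span `ℂ^{2g}` -/

omit [Fintype ι] [DecidableEq ι] in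
/-- A primitive element of a CM field over `ℚ` is non-zero (`ℚ(0) = ℚ ≠ K` because complex conjugation is a
non-trivial automorphism). [cite: Shimura1998, §5.1 Lemma 1] -/
private theorem primitive_ne_zero (i : ι) {x₀ : K i} (hx₀ : ℚ⟮x₀⟯ = ⊤) : x₀ ≠ 0 := by
  rintro rfl
  rw [IntermediateField.adjoin_zero] at hx₀
  apply IsCMField.complexConj_ne_one (K i)
  ext x
  have hx : x ∈ (⊥ : IntermediateField ℚ (K i)) := by rw [hx₀]; exact IntermediateField.mem_top
  obtain ⟨q, rfl⟩ := IntermediateField.mem_bot.mp hx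
  change IsCMField.complexConj (K i) (algebraMap ℚ (K i) q) = algebraMap ℚ (K i) q
  rw [eq_ratCast, map_ratCast]

/-- **On the range of the idempotent `eᵢ = act(ιᵢ 1)` the common eigenlines of `Kᵢ` span**: for every
`v ∈ ℂ^{2g}`, `eᵢ v ∈ ⨆_ρ V_{i,ρ}`.  Core of the structure lemma (primitive element, semisimplicity, embeddings =
roots of the minimal polynomial). [cite: Shimura1998, §5.1 Lemma 1] [cite: MilneCM2006, Ch. I §1] -/
theorem mulVec_single_one_mem_iSup_eigenline (i : ι) (v : Fin g ⊕ Fin g → ℂ) :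
    (c.actMatrix (Pi.single i 1)).map (algebraMap ℚ ℂ) *ᵥ v ∈
      ⨆ ρ : K i →+* ℂ, ⨅ x : K i,
        Module.End.eigenspace (Matrix.toLin' ((c.actMatrix (Pi.single i x)).map (algebraMap ℚ ℂ))) (ρ x) := by
  classical
  -- the complexified action as a `ℚ`-algebra homomorphism `A : F → M_{2g}(ℂ)`
  let A : (Π i, K i) →ₐ[ℚ] Matrix (Fin g ⊕ Fin g) (Fin g ⊕ Fin g) ℂ :=
    ((Algebra.ofId ℚ ℂ).mapMatrix.comp
        (LinearMap.toMatrixAlgEquiv' (R := ℚ) (n := Fin g ⊕ Fin g)).toAlgHom).comp c.act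
  have hA : ∀ x, A x = (c.actMatrix x).map (algebraMap ℚ ℂ) := fun x => rfl
  simp only [← hA]
  -- idempotent bookkeeping
  have hAmul : ∀ x y : Π i, K i, A (x * y) = A x * A y := fun x y => map_mul A x y
  have he_mul : ∀ (x : K i) (w : Fin g ⊕ Fin g → ℂ),
      A (Pi.single i x) *ᵥ (A (Pi.single i 1) *ᵥ w) = A (Pi.single i x) *ᵥ w := fun x w => by
    rw [Matrix.mulVec_mulVec, ← hAmul, ← Pi.single_mul, mul_one]
  have he_comm : ∀ (x : K i) (w : Fin g ⊕ Fin g → ℂ),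
      A (Pi.single i 1) *ᵥ (A (Pi.single i x) *ᵥ w) = A (Pi.single i x) *ᵥ w := fun x w => by
    rw [Matrix.mulVec_mulVec, ← hAmul, ← Pi.single_mul, one_mul]
  -- a non-zero primitive element `x₀` of `Kᵢ/ℚ`, its minimal polynomial `p`
  obtain ⟨x₀, hx₀⟩ := Field.exists_primitive_element ℚ (K i)
  have hx₀0 : x₀ ≠ 0 := primitive_ne_zero i hx₀
  have hint : IsIntegral ℚ x₀ := Algebra.IsIntegral.isIntegral x₀
  set p : ℚ[X] := minpoly ℚ x₀ with hp
  -- the operator `T = act(ιᵢ x₀)` on `ℂ^{2g}` is killed by `X · p`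
  set y : Π j, K j := Pi.single i x₀ with hy
  set T : Module.End ℂ (Fin g ⊕ Fin g → ℂ) := Matrix.toLin' (A y) with hT
  have hTe : (Matrix.toLinAlgEquiv' : Matrix (Fin g ⊕ Fin g) (Fin g ⊕ Fin g) ℂ ≃ₐ[ℂ] _) (A y) = T := rfl
  have hyp : y * aeval y p = 0 := by
    funext j
    rw [Pi.mul_apply, Pi.zero_apply]
    have hj : (aeval y p) j = aeval (y j) p := by
      rw [← Pi.evalAlgHom_apply ℚ K j (aeval y p), ← Polynomial.aeval_algHom_apply]; rfl
    rw [hj]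
    by_cases hji : j = i
    · subst hji
      rw [show y j = x₀ by rw [hy, Pi.single_eq_same], hp, minpoly.aeval, mul_zero]
    · rw [show y j = 0 by rw [hy, Pi.single_eq_of_ne hji], zero_mul]
  have haeval : ∀ r : ℚ[X], aeval T (r.map (algebraMap ℚ ℂ)) = Matrix.toLin' (A (aeval y r)) := fun r => by
    rw [Polynomial.aeval_map_algebraMap]
    have h1 := Polynomial.aeval_algHom_apply
      ((Matrix.toLinAlgEquiv' : Matrix (Fin g ⊕ Fin g) (Fin g ⊕ Fin g) ℂ ≃ₐ[ℂ]
        Module.End ℂ (Fin g ⊕ Fin g → ℂ)).toAlgHom.restrictScalars ℚ) (A y) r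
    rw [Polynomial.aeval_algHom_apply A y r] at h1
    exact h1
  have hTkill : aeval T ((X * p).map (algebraMap ℚ ℂ)) = 0 := by
    rw [haeval, map_mul, aeval_X, hyp, map_zero, map_zero]
  -- `X · p` is separable (p irreducible separable over `ℚ`, `p(0) ≠ 0`), hence `T` is semisimple
  have hsep : ((X * p).map (algebraMap ℚ ℂ)).Separable := by
    refine Polynomial.Separable.map ?_
    refine Polynomial.separable_X.mul (minpoly.irreducible hint).separable ?_
    refine (Polynomial.irreducible_X.coprime_iff_not_dvd).mpr fun hdvd => ?_
    rw [Polynomial.X_dvd_iff] at hdvd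
    exact minpoly.coeff_zero_ne_zero hint hx₀0 hdvd
  have hss : T.IsSemisimple := Module.End.isSemisimple_of_squarefree_aeval_eq_zero hsep.squarefree hTkill
  have htop : (⨆ μ : ℂ, T.eigenspace μ) = ⊤ := hss.iSup_eigenspace_eq_top
  -- every element of `Kᵢ` is a polynomial in `x₀`
  have hpoly : ∀ x : K i, ∃ r : ℚ[X], aeval x₀ r = x := fun x => by
    have hx : x ∈ (ℚ⟮x₀⟯).toSubalgebra := by
      rw [IntermediateField.mem_toSubalgebra, hx₀]; exact IntermediateField.mem_top
    rw [IntermediateField.adjoin_simple_toSubalgebra_of_isAlgebraic hint.isAlgebraic,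
      Algebra.adjoin_singleton_eq_range_aeval] at hx
    obtain ⟨r, hr⟩ := hx
    exact ⟨r, hr⟩
  -- induction over the eigenspace decomposition of `T`
  have hv : v ∈ ⨆ μ : ℂ, T.eigenspace μ := by rw [htop]; exact Submodule.mem_top
  induction hv using Submodule.iSup_induction' with
  | zero => rw [Matrix.mulVec_zero]; exact Submodule.zero_mem _
  | add w w' _ _ hw hw' => rw [Matrix.mulVec_add]; exact Submodule.add_mem _ hw hw'
  | mem μ w hw =>
    -- `u = eᵢ w` is again a `μ`-eigenvector of `T`, fixed by `eᵢ`
    set u := A (Pi.single i 1) *ᵥ w with hu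
    rw [Module.End.mem_eigenspace_iff, hT, Matrix.toLin'_apply] at hw
    have hTu : A y *ᵥ u = μ • u := by
      rw [hu, hy, he_mul, ← he_comm x₀ w, ← hy, hw, Matrix.mulVec_smul]
    have heu : A (Pi.single i 1) *ᵥ u = u := by
      rw [hu, Matrix.mulVec_mulVec, ← hAmul, ← Pi.single_mul, one_mul]
    by_cases hu0 : u = 0
    · rw [hu0]; exact Submodule.zero_mem _
    -- `μ` is a root of `X · p`, and `μ ≠ 0` (else `u = eᵢ u = act(ιᵢ x₀⁻¹) (T u) = 0`)
    have hμ0 : μ ≠ 0 := by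
      intro hμ
      apply hu0
      calc u = A (Pi.single i 1) *ᵥ u := heu.symm
        _ = A (Pi.single i x₀⁻¹) *ᵥ (A (Pi.single i x₀) *ᵥ u) := by
            conv_rhs => rw [Matrix.mulVec_mulVec, ← hAmul, ← Pi.single_mul, inv_mul_cancel₀ hx₀0]
        _ = 0 := by rw [← hy, hTu, hμ, zero_smul, Matrix.mulVec_zero]
    have hev : T.HasEigenvector μ u :=
      ⟨by rw [Module.End.mem_eigenspace_iff, hT, Matrix.toLin'_apply]; exact hTu, hu0⟩
    have hroot : aeval μ p = 0 := by
      have h1 := Module.End.aeval_apply_of_hasEigenvector (p := (X * p).map (algebraMap ℚ ℂ)) hev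
      rw [hTkill, LinearMap.zero_apply] at h1
      have h2 : ((X * p).map (algebraMap ℚ ℂ)).eval μ = 0 := by
        by_contra hne
        exact hu0 ((smul_eq_zero.mp h1.symm).resolve_left hne)
      rw [Polynomial.map_mul, Polynomial.map_X, Polynomial.eval_mul, Polynomial.eval_X, mul_eq_zero] at h2
      rw [Polynomial.aeval_def, ← Polynomial.eval_map]
      exact h2.resolve_left hμ0
    -- so `μ = ρ x₀` for a complex embedding `ρ`
    have hμmem : μ ∈ (minpoly ℚ x₀).rootSet ℂ := by
      rw [Polynomial.mem_rootSet]
      exact ⟨minpoly.ne_zero hint, hroot⟩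
    rw [← NumberField.Embeddings.range_eval_eq_rootSet_minpoly (K i) ℂ x₀] at hμmem
    obtain ⟨ρ, hρ⟩ := hμmem
    -- `u ∈ V_{i,ρ}`
    refine Submodule.mem_iSup_of_mem ρ ?_
    rw [Submodule.mem_iInf]
    intro x
    rw [Module.End.mem_eigenspace_iff, Matrix.toLin'_apply]
    obtain ⟨r, rfl⟩ := hpoly x
    -- `act(ιᵢ (r(x₀)))·u = act(r(y))·(eᵢ u) = r(T) u = r(μ) u = ρ(r(x₀)) u`
    have hsingle : Pi.single (M := K) i (aeval x₀ r) = aeval y r * Pi.single i 1 := by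
      funext j
      rw [Pi.mul_apply]
      by_cases hji : j = i
      · subst hji
        rw [Pi.single_eq_same, Pi.single_eq_same, mul_one, ← Pi.evalAlgHom_apply ℚ K j (aeval y r),
          ← Polynomial.aeval_algHom_apply]
        change aeval x₀ r = aeval (Pi.single (M := K) j x₀ j) r
        rw [Pi.single_eq_same]
      · rw [Pi.single_eq_of_ne hji, Pi.single_eq_of_ne hji, mul_zero]
    have h3 : aeval (ρ x₀) r = ρ (aeval x₀ r) := Polynomial.aeval_algHom_apply ρ.toRatAlgHom x₀ r
    rw [hsingle, hAmul, ← Matrix.mulVec_mulVec, heu, ← Matrix.toLin'_apply (A (aeval y r)) u, ← haeval,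
      Module.End.aeval_apply_of_hasEigenvector hev, ← hρ, Polynomial.eval_map, ← Polynomial.aeval_def]
    change aeval (ρ x₀) r • u = _
    rw [h3]

/-- **STRUCTURE LEMMA — the common eigenlines of `F = ∏ Kᵢ` span `ℂ^{2g}`**: `⨆_{(i,ρ)} V_{i,ρ} = ⊤` with
`V_{i,ρ} = ⋂_{x ∈ Kᵢ} Eig(act(ιᵢ x), ρ(x))` ([Shimura1998] §5.1 Lemma 1: over `ℂ` a representation of the CM algebra `F`
is a direct sum of the characters `x ↦ ρ(xᵢ)`).  From `v = Σᵢ eᵢ v` (`Σᵢ ιᵢ 1 = 1`) and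
`mulVec_single_one_mem_iSup_eigenline`. [cite: Shimura1998, §5.1 Lemma 1] [cite: MilneCM2006, Ch. I §1]
[cite: Deligne1971TravauxShimura, 4.18 p. 150] -/
theorem iSup_eigenline_eq_top :
    (⨆ q : Σ i, (K i →+* ℂ), ⨅ x : K q.1,
      Module.End.eigenspace (Matrix.toLin' ((c.actMatrix (Pi.single q.1 x)).map (algebraMap ℚ ℂ))) (q.2 x)) = ⊤ := by
  classical
  rw [eq_top_iff]
  rintro v -
  -- `v = Σᵢ eᵢ v`
  have hs : (∑ i, Pi.single (M := K) i (1 : K i)) = 1 := by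
    have := Finset.univ_sum_single (1 : Π i, K i)
    simpa only [Pi.one_apply] using this
  have h1 : (∑ i, c.actMatrix (Pi.single i (1 : K i))) = 1 := by
    rw [show (∑ i, c.actMatrix (Pi.single i (1 : K i))) = c.actMatrix (∑ i, Pi.single i (1 : K i)) by
      simp only [actMatrix_def, map_sum], hs, c.actMatrix_one]
  have hsum : (∑ i, (c.actMatrix (Pi.single i (1 : K i))).map (algebraMap ℚ ℂ)) = 1 := by
    calc (∑ i, (c.actMatrix (Pi.single i (1 : K i))).map (algebraMap ℚ ℂ))
        = (algebraMap ℚ ℂ).mapMatrix (∑ i, c.actMatrix (Pi.single i (1 : K i))) := by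
          rw [map_sum]; rfl
      _ = 1 := by rw [h1, map_one]
  have hv : v = ∑ i, (c.actMatrix (Pi.single i (1 : K i))).map (algebraMap ℚ ℂ) *ᵥ v := by
    rw [← Matrix.sum_mulVec, hsum, Matrix.one_mulVec]
  rw [hv]
  refine Submodule.sum_mem _ fun i _ => ?_
  have hle : (⨆ ρ : K i →+* ℂ, ⨅ x : K i,
      Module.End.eigenspace (Matrix.toLin' ((c.actMatrix (Pi.single i x)).map (algebraMap ℚ ℂ))) (ρ x)) ≤
      ⨆ q : Σ i, (K i →+* ℂ), ⨅ x : K q.1,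
        Module.End.eigenspace (Matrix.toLin' ((c.actMatrix (Pi.single q.1 x)).map (algebraMap ℚ ℂ))) (q.2 x) :=
    iSup_le fun ρ => le_iSup (fun q : Σ i, (K i →+* ℂ) => ⨅ x : K q.1,
      Module.End.eigenspace (Matrix.toLin' ((c.actMatrix (Pi.single q.1 x)).map (algebraMap ℚ ℂ))) (q.2 x)) ⟨i, ρ⟩
  exact hle (c.mulVec_single_one_mem_iSup_eigenline i v)

/-! ### §2. The special point is determined by the CM types -/

variable {c}

/-- **The complexified special points agree**: if `(c, J, Φ)` and `(c, J′, Φ)` are special pairs with the same CM types then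
`J ⊗ ℂ = J′ ⊗ ℂ` — both are `+i` on `V_{i,ρ}` for `ρ ∈ Φᵢ` and `−i` on `V_{i,ρ}` for `ρ ∉ Φᵢ` (the `IsSpecial` clause), and
the `V_{i,ρ}` span (§1). [cite: Milne2005ShimuraVarieties, Ex. 12.4 (b) p. 112] [cite: Deligne1971TravauxShimura, 4.18 p. 150] -/
theorem IsSpecial.map_coe_eq_map_coe {J J' : C0pm δ} {Φ : ∀ i, CMType (K i)} (h : c.IsSpecial J Φ)
    (h' : c.IsSpecial J' Φ) :
    (J : Matrix (Fin g ⊕ Fin g) (Fin g ⊕ Fin g) ℝ).map (algebraMap ℝ ℂ) =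
      (J' : Matrix (Fin g ⊕ Fin g) (Fin g ⊕ Fin g) ℝ).map (algebraMap ℝ ℂ) := by
  classical
  apply Matrix.toLin'.injective
  refine LinearMap.ext fun v => ?_
  have hv : v ∈ (⨆ q : Σ i, (K i →+* ℂ), ⨅ x : K q.1,
      Module.End.eigenspace (Matrix.toLin' ((c.actMatrix (Pi.single q.1 x)).map (algebraMap ℚ ℂ))) (q.2 x)) := by
    rw [c.iSup_eigenline_eq_top]; exact Submodule.mem_top
  induction hv using Submodule.iSup_induction' with
  | zero => rw [map_zero, map_zero]
  | add w w' _ _ hw hw' => rw [map_add, map_add, hw, hw']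
  | mem q w hw =>
    obtain ⟨i, ρ⟩ := q
    rw [Submodule.mem_iInf] at hw
    have hwx : ∀ x : K i, (c.actMatrix (Pi.single i x)).map (algebraMap ℚ ℂ) *ᵥ w = ρ x • w := fun x => by
      have := hw x
      rwa [Module.End.mem_eigenspace_iff, Matrix.toLin'_apply] at this
    rw [Matrix.toLin'_apply, Matrix.toLin'_apply]
    by_cases hρ : ρ ∈ (Φ i).1
    · rw [(h.2 i ρ w hwx).1 hρ, (h'.2 i ρ w hwx).1 hρ]
    · rw [(h.2 i ρ w hwx).2 hρ, (h'.2 i ρ w hwx).2 hρ]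

/-- **HEAD — THE SPECIAL POINT IS DETERMINED BY THE CM TYPES** ([Milne2005ShimuraVarieties] Ex. 12.4 (b): «`h_Φ(z)` acts on
`V_φ` as multiplication by `φ(z)`», so `h_Φ` is a function of `Φ`; [Deligne1971TravauxShimura] 4.18): two special pairs
`(c, J, Φ)`, `(c, J′, Φ)` over the same CM structure with the same types have the same complex structure, `J = J′` as real
matrices. [cite: Milne2005ShimuraVarieties, Ex. 12.4 (b) p. 112] [cite: Deligne1971TravauxShimura, 4.18 p. 150] -/
theorem IsSpecial.coe_eq_coe {J J' : C0pm δ} {Φ : ∀ i, CMType (K i)} (h : c.IsSpecial J Φ) (h' : c.IsSpecial J' Φ) :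
    (J : Matrix (Fin g ⊕ Fin g) (Fin g ⊕ Fin g) ℝ) = (J' : Matrix (Fin g ⊕ Fin g) (Fin g ⊕ Fin g) ℝ) :=
  Matrix.map_injective (RingHom.injective (algebraMap ℝ ℂ)) (h.map_coe_eq_map_coe h')

/-- The same as an equality in `S^± = C0pm δ`. [cite: Milne2005ShimuraVarieties, Ex. 12.4 (b) p. 112] -/
theorem IsSpecial.eq {J J' : C0pm δ} {Φ : ∀ i, CMType (K i)} (h : c.IsSpecial J Φ) (h' : c.IsSpecial J' Φ) :
    J = J' :=
  Subtype.ext (h.coe_eq_coe h')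

end CMStructure

end Literature.AlgebraicGeometry.ModuliOfAbelianVarieties

end
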